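import Mathlib

/-!
# `BalabanUV.Beta.GAN24.FibreBlockSolve` — binder row G-an2-4 / (CONV-C), road P1-fibre, the PER-FINE-MOMENTUM ALGEBRA of `SKELETON-P1.md` S1b′ (node N05/N07′):
# the explicit solution of one diagonal block `T(k)` of the Bloch fibre matrix of the typed `U = 1` KKT system

NOT IN PRINT; OUR PROOF ATTEMPT.  HONEST FRAMING (cell contract, verbatim): «discharging `BetaPertH` makes Bałaban's UV stability UNCONDITIONAL — a real
constructive-QFT result; it is NOT the continuum limit and NOT the Clay problem.»  HONEST DEPENDENCY (verbatim): «continuum YM on T⁴ ⇐ BetaPertH ∧ nine spine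
estimates (0/9 proved); BetaPertH ⇐ (D1) ∧ (D4) ∧ CAP+tail; G-an2-4 gates asym, D1 and NE2/3/4.»  [folklore] finite-dimensional algebra over `ℂ` (no estimate, no cited
fact, no wall binder).  NOT summit progress.

## What is proved
Abstract data for ONE fine momentum: vectors `∂, ∂♭ : Fin D → ℂ` (the forward / reflected difference symbols `∂̂(k)`, `∂̂♭(k)` of `GAN24/FibreSymbols`), the Laplacian symbol
`L = Σ_κ ∂♭_κ ∂_κ` assumed `≠ 0` (i.e. `(p, m) ≠ (0, 0)`), a right-hand side `g : Fin D → ℂ` (in S1b′: `g = f̂(m) + χ̂_m Σ̄_m φ`, the force plus the constraint-multiplier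
feed) and a scalar `cc` (`= χ̂_m c`, the block-constant gauge feed).  The block equations of `SKELETON-P1.md` S1a at this momentum are
  (EL)  `2(L·A_κ − ∂_κ (∂♭·A)) − L ∂_κ μ = g_κ`      (curl–curl symbol `2(L·1 − ∂∂♭ᵀ)` — `FibreSymbols.curvAdj_curv_plane`; gauge column `∂L` — `gauge_plane`),
  (G)   `L (∂♭·A) = cc`                              (G-row symbol `L ∂♭ᵀ` — `Gamma_plane`),
and this file PROVES that the EXPLICIT pair
  `Asol κ = (g_κ − ∂_κ (∂♭·g)/L)/(2L) + (cc/L²) ∂_κ`    (transverse massless propagator `1/(2L)` on `Π⊥ g` + a pure-gauge part driven by `cc` only),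
  `musol  = −(∂♭·g)/L²`                                 (the gauge multiplier: the longitudinal part of the feed, twice integrated)
solves (EL) and (G) (`EL_row_Asol`, `G_row_Asol`), and that the longitudinal content of `Asol` is `∂♭·Asol = cc/L` (`dot_Asol`).  Uniqueness is NOT claimed
here (it is the bijectivity of the fibre matrix, an2's `BlochFibreMatrix.det_fibreMatrix_blochChar_ne_zero`, once the arrow form S1a is in place).
Consequence recorded in the skeleton (not formalised here): with these per-momentum formulas the global rows (M), (Q) become the (D+1)×(D+1) capacitance
system of alias sums — the only non-explicit inverse left in the fibre.  Numerically this closed form agrees with the full arrow system to relative 1e-14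
(`SKELETON-P1.md` §7(a)).
-/

open Finset
open scoped BigOperators

namespace Summit.QuantumFields.BalabanUV.Beta.GAN24.FibreBlockSolve

variable {D : ℕ}

/-- [folklore] The bilinear pairing `u·v = Σ_κ u_κ v_κ` on `ℂ^D` (no conjugation: `∂♭` already carries the reflection). -/
def dot (u v : Fin D → ℂ) : ℂ := ∑ κ, u κ * v κ

/-- [folklore] `dot` is additive in the second slot. -/
theorem dot_add_right (u v w : Fin D → ℂ) : dot u (v + w) = dot u v + dot u w := by
  unfold dot; rw [← Finset.sum_add_distrib]; exact Finset.sum_congr rfl fun κ _ => by rw [Pi.add_apply]; ring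

/-- [folklore] `dot` is homogeneous in the second slot. -/
theorem dot_smul_right (u v : Fin D → ℂ) (a : ℂ) : dot u (fun κ => a * v κ) = a * dot u v := by
  unfold dot; rw [Finset.mul_sum]; exact Finset.sum_congr rfl fun κ _ => by ring

/-- [folklore] THE EXPLICIT FIELD SOLUTION of the block equations: transverse part `Π⊥g/(2L)` plus the pure-gauge part `(cc/L²)∂`. -/
noncomputable def Asol (dd db g : Fin D → ℂ) (L cc : ℂ) : Fin D → ℂ :=
  fun κ => (g κ - dd κ * dot db g / L) / (2 * L) + (cc / L ^ 2) * dd κ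

/-- [folklore] THE EXPLICIT GAUGE-MULTIPLIER SOLUTION `−(∂♭·g)/L²`. -/
noncomputable def musol (db g : Fin D → ℂ) (L : ℂ) : ℂ := -(dot db g) / L ^ 2

/-- [folklore] The longitudinal content of the explicit solution: `∂♭·Asol = cc/L` (the transverse part is annihilated by `∂♭·`, using `∂♭·∂ = L`). -/
theorem dot_Asol (dd db g : Fin D → ℂ) {L : ℂ} (hL : L ≠ 0) (hLdef : dot db dd = L) (cc : ℂ) :
    dot db (Asol dd db g L cc) = cc / L := by
  have h : Asol dd db g L cc = (fun κ => (1 / (2 * L)) * g κ) + (fun κ => (-(dot db g / L) / (2 * L) + cc / L ^ 2) * dd κ) := by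
    funext κ; simp only [Asol, Pi.add_apply]; ring
  rw [h, dot_add_right, dot_smul_right, dot_smul_right, hLdef]
  field_simp
  ring

/-- [folklore] **THE G ROW HOLDS**: `L (∂♭·Asol) = cc`. -/
theorem G_row_Asol (dd db g : Fin D → ℂ) {L : ℂ} (hL : L ≠ 0) (hLdef : dot db dd = L) (cc : ℂ) :
    L * dot db (Asol dd db g L cc) = cc := by
  rw [dot_Asol dd db g hL hLdef cc]; field_simp

/-- [folklore] **THE EULER–LAGRANGE ROWS HOLD**: `2(L·Asol_κ − ∂_κ (∂♭·Asol)) − L ∂_κ musol = g_κ` for every component `κ`. -/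
theorem EL_row_Asol (dd db g : Fin D → ℂ) {L : ℂ} (hL : L ≠ 0) (hLdef : dot db dd = L) (cc : ℂ) (κ : Fin D) :
    2 * (L * Asol dd db g L cc κ - dd κ * dot db (Asol dd db g L cc)) - L * dd κ * musol db g L = g κ := by
  rw [dot_Asol dd db g hL hLdef cc]
  simp only [Asol, musol]
  field_simp
  ring

/-- [folklore] WITH SOURCES SPLIT AS IN S1b′ (`g = f + χ̂·Σ̄φ`, the second summand being the constraint feed `e`): the EL rows read
`2(L·A_κ − ∂_κ(∂♭·A)) − L∂_κ μ − e_κ = f_κ` — the form of the EL row of `BlochFibreMatrix.resid` in fine-momentum variables (`−adjContourSum φ` is `−e`). -/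
theorem EL_row_Asol_split (dd db f e : Fin D → ℂ) {L : ℂ} (hL : L ≠ 0) (hLdef : dot db dd = L) (cc : ℂ) (κ : Fin D) :
    2 * (L * Asol dd db (f + e) L cc κ - dd κ * dot db (Asol dd db (f + e) L cc)) - L * dd κ * musol db (f + e) L - e κ = f κ := by
  rw [EL_row_Asol dd db (f + e) hL hLdef cc κ, Pi.add_apply]
  ring

/-- [folklore] THE GAUGE MULTIPLIER DROPS OUT FOR CO-CLOSED FEEDS: if `∂♭·g = 0` then `musol = 0` (the fibre form of an5's `wM_eq_zero` / p3's
`gaugeMultiplier_eq_zero`: minimiser columns and conserved sources carry no weak-gauge multiplier). -/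
theorem musol_eq_zero_of_coclosed (db g : Fin D → ℂ) (L : ℂ) (h : dot db g = 0) : musol db g L = 0 := by
  simp [musol, h]

/-- [folklore] … and then the field solution is `g/(2L)` plus the pure-gauge part: transverse propagator only. -/
theorem Asol_of_coclosed (dd db g : Fin D → ℂ) (L cc : ℂ) (h : dot db g = 0) (κ : Fin D) :
    Asol dd db g L cc κ = g κ / (2 * L) + (cc / L ^ 2) * dd κ := by
  simp [Asol, h]

end Summit.QuantumFields.BalabanUV.Beta.GAN24.FibreBlockSolve
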